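import Mathlib
import Literature.AlgebraicGeometry.Resolution.ReAdaptation
import Literature.AlgebraicGeometry.Resolution.PolygonChartTransport
import HarnessLib

/-!
# Monic elements and their transport through the charts

Topic: `Literature/AlgebraicGeometry/Resolution`. The element `f` with `in_𝔪(f) = F(Y) = Y^μ`
(Cossart–Jannsen–Saito, LNM 2270, (12.1)/(14.3): "`in_δ(f)_{(y,u)} = F(Y) + …`"; Cossart–Piltant
2008, (10)–(11): "`F(Y₁,Y₂,Y₃) := in_x f ∈ k(x)[Y]` … `y₁^{−μ} f ≡ F(1, y₂′, y₃′) mod (y₁′)`") keeps a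
unit `Y′^μ`-coefficient in its weak transform at every point of the exceptional divisor. In the
language of `ReAdaptation` (`HasMonic`) we PROVE (no facts):

* `exists_monic_of_lt_deltaS` — at an adapted point (`δ > 1`) with `ord J = μ` there is
  `g ∈ J` and a unit `f` with `g − f y^μ ∈ 𝔪^{μ+1}`;
* `hasMonic_of_sub_mem_weightedIdealW` — if `g′ − f′ y′^μ` is small for a weight `(1, N, N)`,
  `N > μ`, with `f′` a unit and `g′ ∈ J′ ⊆ 𝔪′^μ`, then `HasMonic c′ J′ μ`;
* `hasMonic_colon_of_monic` — **transport**: for any chart `φ` with `φ(y) = φ(u_j) y′`,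
  `c′_j = φ(u_j)`, `φ(𝔪) R′ ⊆ (c′₁, c′₂)` and a cofactor `φ(g) = φ(u_j)^μ g′`, nearness
  (`J′ ⊆ 𝔪′^μ`) gives `HasMonic c′ J′ μ` (covers the origin of both charts of a point blow-up,
  the non-rational chart, and the chart of a curve blow-up).

## Sources

* V. Cossart, U. Jannsen, S. Saito, LNM 2270 (2020), (12.1), Lemma 12.1 (1)–(2), Lemma 14.1.
  [CossartJannsenSaito2020]
* V. Cossart, O. Piltant, J. Algebra 320 (2008), §4, (10)–(11). [CossartPiltant2008]
-/

noncomputable section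

open IsLocalRing MvPolynomial

namespace Literature.AlgebraicGeometry.Resolution

universe u

/-! ## Monic elements at an adapted point -/

section Monic

variable {R : Type u} [CommRing R] [IsRegularLocalRing R] (c : Fin 3 → R)
  (hgen : Ideal.span {c 0, c 1, c 2} = maximalIdeal R) (hdim : ringKrullDim R = 3)
  {J : Ideal R} {μ : ℕ}

include hgen hdim in
/-- **A monic element at an adapted point**: if `δ > 1` (all `in_μ` are multiples of `Y^μ`) and
`J ⊆ 𝔪^μ` has an element of order exactly `μ`, then some `g ∈ J` satisfies `g − f y^μ ∈ 𝔪^{μ+1}`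
with `f` a unit. [cite: CossartJannsenSaito2020, (12.1)] [cite: CossartPiltant2008, (10)] -/
theorem exists_monic_of_lt_deltaS (hJμ : J ≤ maximalIdeal R ^ μ) (hδ : μ.factorial < deltaS c J μ)
    {g : R} (hgJ : g ∈ J) (hg : g ∉ maximalIdeal R ^ (μ + 1)) :
    ∃ f : R, IsUnit f ∧ g - f * c 0 ^ μ ∈ maximalIdeal R ^ (μ + 1) := by
  classical
  have hgenr := span_range_eq_of_span_triple c hgen
  have h1 : ∀ i, 0 < (fun _ : Fin 3 => (1 : ℕ)) i := fun _ => Nat.one_pos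
  have hg1 : g ∈ weightedIdealW c (fun _ => 1) μ := by rw [weightedIdealW_one_eq_pow c hgenr]; exact hJμ hgJ
  obtain ⟨a, ha⟩ := forall_initialForms_of_lt_deltaS c hgen hdim hJμ hδ _
    ((mem_initialForms_iff_exists_inForm c hgen hdim hJμ _).mpr ⟨g, hgJ, rfl⟩)
  obtain ⟨F, hF, hFP, hrem⟩ := isInForm_inForm c hgen hdim h1 hg1
  rw [ha] at hFP
  have ha0 : a ≠ 0 := by
    intro h0
    apply hg
    rw [← weightedIdealW_one_eq_pow c hgenr, ← inForm_eq_zero_iff c hgen hdim h1 hg1, ha, h0, C_0, zero_mul]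
  set f := F.coeff (Finsupp.single 0 μ) with hf
  have hfres : residue R f = a := by
    have := congrArg (fun P => P.coeff (Finsupp.single 0 μ)) hFP
    simp only [coeff_map, coeff_C_mul, coeff_X_pow] at this
    simpa using this
  have hfu : IsUnit f := by
    by_contra hnu
    have : f ∈ maximalIdeal R := (mem_maximalIdeal _).mpr hnu
    rw [← residue_eq_zero_iff, hfres] at this
    exact ha0 this
  refine ⟨f, hfu, ?_⟩
  have hmon : (C f * X 0 ^ μ : MvPolynomial (Fin 3) R).IsWeightedHomogeneous (fun _ => (1 : ℕ)) μ := by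
    rw [C_mul_X_pow_eq_monomial]
    exact isWeightedHomogeneous_monomial _ _ _ (by rw [weight_one_eq]; simp)
  have hG : (F - C f * X 0 ^ μ).IsWeightedHomogeneous (fun _ => (1 : ℕ)) μ :=
    (weightedHomogeneousSubmodule R (fun _ : Fin 3 => (1 : ℕ)) μ).sub_mem hF hmon
  have hcoef : ∀ m, (F - C f * X 0 ^ μ).coeff m ∈ maximalIdeal R := by
    intro m
    rw [← residue_eq_zero_iff, ← coeff_map, map_sub, hFP, map_mul, map_C, map_pow, map_X, hfres,
      sub_self, coeff_zero]
  have hmem := eval_mem_succ_of_coeff_mem c hgenr h1 hG hcoef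
  rw [map_sub, map_mul, eval_C, map_pow, eval_X, weightedIdealW_one_eq_pow c hgenr] at hmem
  rw [weightedIdealW_one_eq_pow c hgenr] at hrem
  have : g - f * c 0 ^ μ = (g - eval c F) + (eval c F - f * c 0 ^ μ) := by ring
  rw [this]; exact Ideal.add_mem _ hrem hmem

/-- The weight `(1, N, N)`. [folklore] -/
def wN (N : ℕ) : Fin 3 → ℕ := ![1, N, N]

omit [IsRegularLocalRing R] in
/-- Components. [folklore] -/
theorem wN_apply (N : ℕ) : wN N 0 = 1 ∧ wN N 1 = N ∧ wN N 2 = N := ⟨rfl, rfl, rfl⟩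

omit [IsRegularLocalRing R] in
/-- The weight `(1, N, N)` is positive for `N ≥ 1`. [folklore] -/
theorem wN_pos {N : ℕ} (hN : 1 ≤ N) : ∀ i, 0 < wN N i := by
  intro i; fin_cases i
  · exact Nat.one_pos
  · exact hN
  · exact hN

omit [IsRegularLocalRing R] in
/-- The weight of `y^μ` is `μ`. [folklore] -/
theorem weight_wN_single_zero (N μ : ℕ) : Finsupp.weight (wN N) (Finsupp.single 0 μ) = μ := by
  rw [Finsupp.weight_apply, Finsupp.sum_single_index (by simp)]; simp [wN]

include hgen hdim in
/-- **`HasMonic` from a small `g − f y^μ`**: if `f` is a unit, `g ∈ J ⊆ 𝔪^μ` and `g − f y^μ` lies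
in `F^{(1,N,N)}_{μ+1}` with `N > μ`, then `in_μ(g)` has a nonzero `Y^μ`-coefficient.
[cite: CossartPiltant2008, (11)] [cite: CossartJannsenSaito2020, Lemma 12.1 (2)] -/
theorem hasMonic_of_sub_mem_weightedIdealW (hJμ : J ≤ maximalIdeal R ^ μ) {g : R} (hgJ : g ∈ J)
    {f : R} (hf : IsUnit f) {N : ℕ} (hN : μ + 1 ≤ N)
    (hr : g - f * c 0 ^ μ ∈ weightedIdealW c (wN N) (μ + 1)) : HasMonic c J μ := by
  classical
  have hgenr := span_range_eq_of_span_triple c hgen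
  have h1 : ∀ i, 0 < (fun _ : Fin 3 => (1 : ℕ)) i := fun _ => Nat.one_pos
  have hw : ∀ i, 0 < wN N i := wN_pos (by omega)
  -- `(μ, 0, 0)` is an initial term for `(1, N, N)`
  have hinitW : IsInitialTerm c (wN N) g (Finsupp.single 0 μ) := by
    refine ⟨C f * X 0 ^ μ, ?_, ?_, ?_⟩
    · rw [weight_wN_single_zero, C_mul_X_pow_eq_monomial]
      exact isWeightedHomogeneous_monomial _ _ _ (weight_wN_single_zero N μ)
    · rwa [coeff_C_mul, coeff_X_pow, if_pos rfl, mul_one]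
    · rwa [weight_wN_single_zero, map_mul, eval_C, map_pow, eval_X]
  -- a fine unit representative
  obtain ⟨G, hGu, -, hGrem⟩ := exists_unitRep c hgenr g (μ + 2)
  have hremW : g - eval c G ∈ weightedIdealW c (wN N) (μ + 2) := pow_maximalIdeal_le_weightedIdealW c hgenr hw _ hGrem
  have hrem1 : g - eval c G ∈ weightedIdealW c (fun _ => 1) (μ + 2) := pow_maximalIdeal_le_weightedIdealW c hgenr h1 _ hGrem
  have hsupp : Finsupp.single 0 μ ∈ G.support :=
    ((isInitialTerm_iff_of_unitRep c hgen hdim hw hGu hremW (by rw [weight_wN_single_zero]; omega)).mp hinitW).1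
  have hg1 : g ∈ weightedIdealW c (fun _ => 1) μ := by rw [weightedIdealW_one_eq_pow c hgenr]; exact hJμ hgJ
  have hmin1 : ∀ m ∈ G.support, μ ≤ Finsupp.weight (fun _ : Fin 3 => (1 : ℕ)) m :=
    (mem_weightedIdealW_iff_of_unitRep c hgen hdim h1 hGu hrem1 (by omega)).mp hg1
  have hwt1 : Finsupp.weight (fun _ : Fin 3 => (1 : ℕ)) (Finsupp.single 0 μ) = μ := by
    rw [weight_one_eq]; simp
  refine ⟨g, hgJ, ?_⟩
  rw [inForm_eq_map_component c hgen hdim h1 (by omega) hrem1 hmin1, coeff_map,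
    coeff_weightedHomogeneousComponent, if_pos hwt1, residue_ne_zero_iff_isUnit]
  · exact hGu _ hsupp

end Monic

/-! ## Transport through the charts -/

section Transport

variable {R R' : Type u} [CommRing R] [CommRing R'] (φ : R →+* R') {c : Fin 3 → R}
  {c' : Fin 3 → R'}

/-- `(c′₁, c′₂) ⊆ F^{(1,N,N)}_N`. [folklore] -/
theorem span_pair_le_weightedIdealW_wN (N : ℕ) :
    Ideal.span {c' 1, c' 2} ≤ weightedIdealW c' (wN N) N := by
  have h1 : c' 1 ∈ weightedIdealW c' (wN N) N := by
    have : c' 1 = monom3 c' (Finsupp.single 1 1) := by simp [monom3]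
    rw [this]
    refine monomial_mem_weightedIdealW c' _ ?_
    rw [Finsupp.weight_apply, Finsupp.sum_single_index (by simp)]; simp [wN]
  have h2 : c' 2 ∈ weightedIdealW c' (wN N) N := by
    have : c' 2 = monom3 c' (Finsupp.single 2 1) := by simp [monom3]
    rw [this]
    refine monomial_mem_weightedIdealW c' _ ?_
    rw [Finsupp.weight_apply, Finsupp.sum_single_index (by simp)]; simp [wN]
  rw [Ideal.span_le]
  intro x hx
  rcases hx with rfl | hx
  · exact h1
  · rw [Set.mem_singleton_iff] at hx; rw [hx]; exact h2

/-- `F_0 = R` for any weight. [folklore] -/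
theorem weightedIdealW_zero_eq_top (w : Fin 3 → ℕ) : weightedIdealW c' w 0 = ⊤ := by
  rw [eq_top_iff]
  intro x _
  have h1 : (1 : R') ∈ weightedIdealW c' w 0 := by
    have := monomial_mem_weightedIdealW c' w (ρ := 0) (e := 0) (by simp)
    simpa [monom3] using this
  simpa using Ideal.mul_mem_left _ x h1

/-- Powers: `I ⊆ F_a ⇒ I^k ⊆ F_{a k}`. [folklore] -/
theorem pow_le_weightedIdealW_of_le {I : Ideal R'} {w : Fin 3 → ℕ} {a : ℕ}
    (h : I ≤ weightedIdealW c' w a) (k : ℕ) : I ^ k ≤ weightedIdealW c' w (a * k) := by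
  induction k with
  | zero => rw [pow_zero, mul_zero, weightedIdealW_zero_eq_top, Ideal.one_eq_top]
  | succ k ih =>
    rw [pow_succ, Nat.mul_succ]
    exact (Ideal.mul_mono ih h).trans (weightedIdealW_mul_le c' w _ _)

variable [IsRegularLocalRing R'] [IsLocalRing R]
  (hgen' : Ideal.span {c' 0, c' 1, c' 2} = maximalIdeal R') (hdim' : ringKrullDim R' = 3)

include hgen' hdim' in
/-- **Transport of monic elements through a chart.** Let `φ : R → R′` with `c′_j = φ(u_j)` for
`j ∈ {1, 2}`, `φ(y) = φ(u_j) · y′`, `φ(𝔪) R′ ⊆ (c′₁, c′₂)`; let `g ∈ 𝔪` with `g − f y^μ ∈ 𝔪^{μ+1}`,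
`φ(f)` a unit, and a cofactor `φ(g) = φ(u_j)^μ g′` with `g′` in an ideal `J′ ⊆ 𝔪′^μ` (nearness).
Then `in_μ(g′)` has a nonzero `Y′^μ`-coefficient: `HasMonic c′ J′ μ`.
[cite: CossartPiltant2008, (11)] [cite: CossartJannsenSaito2020, Lemma 12.1 (2), Lemma 14.1 (2)] -/
theorem hasMonic_of_monic_of_chart {j : Fin 3} (hj : j = 1 ∨ j = 2) (hcj : c' j = φ (c j))
    (h₀ : φ (c 0) = φ (c j) * c' 0) (hφ : (maximalIdeal R).map φ ≤ Ideal.span {c' 1, c' 2})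
    {μ : ℕ} {J' : Ideal R'} (hJμ' : J' ≤ maximalIdeal R' ^ μ)
    {g f : R} (hgr : g - f * c 0 ^ μ ∈ maximalIdeal R ^ (μ + 1)) (hfu : IsUnit (φ f))
    {g' : R'} (hg' : φ g = φ (c j) ^ μ * g') (hg'J : g' ∈ J') : HasMonic c' J' μ := by
  set N := μ + 1 with hN
  have hw : ∀ i, 0 < wN N i := wN_pos (by omega)
  -- `φ(g − f y^μ) ∈ F′^{(1,N,N)}_{N(μ+1)}`
  have hmem : φ (g - f * c 0 ^ μ) ∈ weightedIdealW c' (wN N) (N * (μ + 1)) := by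
    have h1 : φ (g - f * c 0 ^ μ) ∈ ((maximalIdeal R).map φ) ^ (μ + 1) := by
      rw [← Ideal.map_pow]; exact Ideal.mem_map_of_mem _ hgr
    exact pow_le_weightedIdealW_of_le (hφ.trans (span_pair_le_weightedIdealW_wN N)) (μ + 1) h1
  -- `φ(g − f y^μ) = φ(u_j)^μ (g′ − φ(f) y′^μ)` and `φ(u_j)^μ = c′^{single j μ}`
  have hfac : φ (g - f * c 0 ^ μ) = monom3 c' (Finsupp.single j μ) * (g' - φ f * c' 0 ^ μ) := by
    have hmon : monom3 c' (Finsupp.single j μ) = φ (c j) ^ μ := by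
      rcases hj with rfl | rfl <;> simp [monom3, hcj]
    rw [hmon, map_sub, hg', map_mul, map_pow, h₀]; ring
  have hwt : Finsupp.weight (wN N) (Finsupp.single j μ) = μ * N := by
    rw [Finsupp.weight_apply, Finsupp.sum_single_index (by simp), smul_eq_mul]
    rcases hj with rfl | rfl <;> simp [wN]
  have hdiv : g' - φ f * c' 0 ^ μ ∈ weightedIdealW c' (wN N) (μ + 1) := by
    refine mem_weightedIdealW_of_monom3_mul_mem c' hgen' hdim' hw (Finsupp.single j μ) ?_
    rw [hwt, ← hfac]
    have : μ + 1 + μ * N = N * (μ + 1) := by rw [hN]; ring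
    rw [this]; exact hmem
  exact hasMonic_of_sub_mem_weightedIdealW c' hgen' hdim' hJμ' hg'J hfu (le_refl N) hdiv

end Transport

end Literature.AlgebraicGeometry.Resolution
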